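import Summits.CriticalPhenomena.PercolationContinuityZ3.Theorems.PercNearOneGluingNoHeavyLowerTailFourPointFaceDefs
import Mathlib.Data.Real.Basic
import Mathlib.Tactic.Ring
import Mathlib.Tactic.Linarith
import Mathlib.Tactic.Positivity
import Mathlib.Tactic.NormNum
import HarnessLib

/-!
# `NoHeavyLowerTail` (stmt-CriticalPhenomena-4575) — strat-2 exact certificate `strat2_L1_suppV1` for the polarised piece (L1) on the coordinate face supp(V1) = {a|by|c = a|bc|y = a|bcy = ay|bc = ac|by = 0} ("b is joined to c or y only through a"; contains V1 = CUT:a:b|cy). Degree 4, linear multiplier, two SHK3⁺ rows F on (a,b,c) in G and in the gluing G/{a=y} — an independent re-derivation (own engine, own dictionary) of the shape of facecert's p200424, recorded as the STEP-0 parity control of this seat's pipeline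

Support file (prover seat `prim-e3grp-strat-2`, STRATIFIED CERTIFICATES 2 = the method-independent second certificate route;
`--supports stmt-CriticalPhenomena-4575`).  Pure algebra: no sorries, no named facts, no new definitions.  Vocabulary: prim-l12-p6's
homogeneous cell forms `CubicFourPoint.polL₁ / polL₂ / E3h / Hh` (…FourPointFaceDefs; cell order `x₀ = a|b|c|y, x₁ = a|b|cy, x₂ = a|by|c,
x₃ = a|bc|y, x₄ = ay|b|c, x₅ = ac|b|y, x₆ = ab|c|y, x₇ = a|bcy, x₈ = ay|bc, x₉ = ac|by, x₁₀ = acy|b, x₁₁ = ab|cy, x₁₂ = aby|c, x₁₃ = abc|y, x₁₄ = abcy`).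

CERTIFICATE (machine-found by this seat's OWN face/region-stratified Handelman LP over THEOREM rows only — row dictionary generated from the
partition-event semantics on `G` and on the six one-pair gluings `G/{u=v}` (= `G` with the edge `{u,v}` forced), exact reconstruction over ℚ,
two independent exact verifications; config `L1:4:1:0::2,3,7,8,9:CR`; total degree 4, multiplier degree 1, σ-power 0):
  stratum: sub-simplex with zero cells `a|by|c`, `a|bc|y`, `a|bcy`, `ay|bc`, `ac|by`;  region rows: none;
  `(L·M)(x) · σ^0 · polL₁(x) = Σ c · ROW(x) · REGION(x) · x^m`  with every `c ∈ ℕ`, 20 terms, 2 distinct rows, L·M a positive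
  integer combination of 10 monomials.
Each ROW is an instance, written in the cells (of `G` or of a gluing `G/{u=v}`, whose four-point law is the block-merge push-forward), of a TREE THEOREM:
`E3h σ …` of three pairwise separations = 3PT-LB (`…ThreePointLBSwitching`), `E3h σ …` with a group slot = hybrid/group 3PT-LB
(`HybridThreePointLB.sahiE3_hybrid_nonneg`, `GroupThreePointLB.sahiE3_groupPairSep_nonneg`), `Hh σ …` = Harris, `q·t − e₂(u)` = Aas–Gladkov; here they are
HYPOTHESES of the sign corollary (row names below = this seat's dictionary names `FAMILY[context: data]`):
  * `hr0` : `F[G/ay:ay,b,c]`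
  * `hr1` : `F[G:a,b,c]`
NOT here: the measure-level instantiation of the row hypotheses (dictionary step) and the positivity of the multiplier on realizable laws.
[cite: GladkovZimin2024HK, §4 (coordinate/terminal-edge induction behind the polarised pieces; the certificate itself is this programme's)]
-/

namespace Summit.CriticalPhenomena.PercolationContinuityZ3.Theorems

namespace CubicFourPoint

/-- **Exact certificate identity `strat2_L1_suppV1`** (strat-2; integer coefficients after clearing denominators; face cells substituted by `0`):
`(L·M)·σ^0·polL₁ = Σ c·ROW·REGION·monomial`.  Proved by `ring`. -/
theorem strat2_L1_suppV1_identity {R : Type*} [CommRing R] (x₀ x₁ x₄ x₅ x₆ x₁₀ x₁₁ x₁₂ x₁₃ x₁₄ : R) :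
    (2 * x₁₄ + 2 * x₁₃ + 1 * x₁₂ + 2 * x₁₁ + 1 * x₁₀ + 1 * x₆ + 1 * x₅ + 1 * x₄ + 1 * x₁ + 1 * x₀) * polL₁ x₀ x₁ 0 0 x₄ x₅ x₆ 0 0 0 x₁₀ x₁₁ x₁₂ x₁₃ x₁₄
    = (E3h (x₀ + x₁ + x₄ + x₅ + x₆ + x₁₀ + x₁₁ + x₁₂ + x₁₃ + x₁₄) (x₀ + x₁ + x₄ + x₅ + x₆ + x₁₀ + x₁₂) (x₀ + x₄ + x₆ + x₁₂) (x₀ + x₁ + x₄ + x₅ + x₁₀) (x₀ + x₄ + x₆ + x₁₂) (x₀ + x₁ + x₄ + x₅ + x₁₀) (x₀ + x₄) (x₀ + x₄)) * (2 * x₁₄ + 2 * x₁₃ + 1 * x₁₂ + 1 * x₁₁ + 1 * x₁₀ + 1 * x₆ + 1 * x₅ + 1 * x₄ + 1 * x₁ + 1 * x₀)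
      + (E3h (x₀ + x₁ + x₄ + x₅ + x₆ + x₁₀ + x₁₁ + x₁₂ + x₁₃ + x₁₄) (x₀ + x₁ + x₄ + x₅ + x₆ + x₁₀ + x₁₁ + x₁₂) (x₀ + x₁ + x₄ + x₆ + x₁₁ + x₁₂) (x₀ + x₁ + x₄ + x₅ + x₁₀) (x₀ + x₁ + x₄ + x₆ + x₁₁ + x₁₂) (x₀ + x₁ + x₄ + x₅ + x₁₀) (x₀ + x₁ + x₄) (x₀ + x₁ + x₄)) * (2 * x₁₄ + 2 * x₁₃ + 1 * x₁₂ + 2 * x₁₁ + 1 * x₁₀ + 1 * x₆ + 1 * x₅ + 1 * x₄ + 1 * x₁ + 1 * x₀) := by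
  simp only [polL₁, hybE₁, hybE₂, E3h]
  ring

/-- **Sign corollary of `strat2_L1_suppV1`**: on the stratum (cells ≥ 0), the THEOREM rows (hypotheses `hr*`, see the file header for
which tree theorem each instantiates) give `0 ≤ (L·M)·σ^0·polL₁`. -/
theorem strat2_L1_suppV1_mul_nonneg (x₀ x₁ x₄ x₅ x₆ x₁₀ x₁₁ x₁₂ x₁₃ x₁₄ : ℝ)
    (hx₀ : 0 ≤ x₀) (hx₁ : 0 ≤ x₁) (hx₄ : 0 ≤ x₄) (hx₅ : 0 ≤ x₅) (hx₆ : 0 ≤ x₆) (hx₁₀ : 0 ≤ x₁₀) (hx₁₁ : 0 ≤ x₁₁) (hx₁₂ : 0 ≤ x₁₂) (hx₁₃ : 0 ≤ x₁₃) (hx₁₄ : 0 ≤ x₁₄)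
    (hr0 : 0 ≤ E3h (x₀ + x₁ + x₄ + x₅ + x₆ + x₁₀ + x₁₁ + x₁₂ + x₁₃ + x₁₄) (x₀ + x₁ + x₄ + x₅ + x₆ + x₁₀ + x₁₂) (x₀ + x₄ + x₆ + x₁₂) (x₀ + x₁ + x₄ + x₅ + x₁₀) (x₀ + x₄ + x₆ + x₁₂) (x₀ + x₁ + x₄ + x₅ + x₁₀) (x₀ + x₄) (x₀ + x₄))
    (hr1 : 0 ≤ E3h (x₀ + x₁ + x₄ + x₅ + x₆ + x₁₀ + x₁₁ + x₁₂ + x₁₃ + x₁₄) (x₀ + x₁ + x₄ + x₅ + x₆ + x₁₀ + x₁₁ + x₁₂) (x₀ + x₁ + x₄ + x₆ + x₁₁ + x₁₂) (x₀ + x₁ + x₄ + x₅ + x₁₀) (x₀ + x₁ + x₄ + x₆ + x₁₁ + x₁₂) (x₀ + x₁ + x₄ + x₅ + x₁₀) (x₀ + x₁ + x₄) (x₀ + x₁ + x₄)) :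
    0 ≤ (2 * x₁₄ + 2 * x₁₃ + 1 * x₁₂ + 2 * x₁₁ + 1 * x₁₀ + 1 * x₆ + 1 * x₅ + 1 * x₄ + 1 * x₁ + 1 * x₀) * polL₁ x₀ x₁ 0 0 x₄ x₅ x₆ 0 0 0 x₁₀ x₁₁ x₁₂ x₁₃ x₁₄ := by
  rw [strat2_L1_suppV1_identity]
  exact add_nonneg (mul_nonneg (hr0) (add_nonneg (add_nonneg (add_nonneg (add_nonneg (add_nonneg (add_nonneg (add_nonneg (add_nonneg (add_nonneg (mul_nonneg ((by norm_num : (0:ℝ) ≤ 2)) hx₁₄) (mul_nonneg ((by norm_num : (0:ℝ) ≤ 2)) hx₁₃)) (mul_nonneg ((by norm_num : (0:ℝ) ≤ 1)) hx₁₂)) (mul_nonneg ((by norm_num : (0:ℝ) ≤ 1)) hx₁₁)) (mul_nonneg ((by norm_num : (0:ℝ) ≤ 1)) hx₁₀)) (mul_nonneg ((by norm_num : (0:ℝ) ≤ 1)) hx₆)) (mul_nonneg ((by norm_num : (0:ℝ) ≤ 1)) hx₅)) (mul_nonneg ((by norm_num : (0:ℝ) ≤ 1)) hx₄)) (mul_nonneg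 ((by norm_num : (0:ℝ) ≤ 1)) hx₁)) (mul_nonneg ((by norm_num : (0:ℝ) ≤ 1)) hx₀))) (mul_nonneg (hr1) (add_nonneg (add_nonneg (add_nonneg (add_nonneg (add_nonneg (add_nonneg (add_nonneg (add_nonneg (add_nonneg (mul_nonneg ((by norm_num : (0:ℝ) ≤ 2)) hx₁₄) (mul_nonneg ((by norm_num : (0:ℝ) ≤ 2)) hx₁₃)) (mul_nonneg ((by norm_num : (0:ℝ) ≤ 1)) hx₁₂)) (mul_nonneg ((by norm_num : (0:ℝ) ≤ 2)) hx₁₁)) (mul_nonneg ((by norm_num : (0:ℝ) ≤ 1)) hx₁₀)) (mul_nonneg ((by norm_num : (0:ℝ) ≤ 1)) hx₆)) (mul_nonneg ((by norm_num : (0:ℝ) ≤ 1)) hx₅)) (mul_nonneg ((by norm_num : (0:ℝ) ≤ 1)) hx₄)) (mul_nonneg ((by norm_num : (0:ℝ) ≤ 1)) hx₁)) (mul_nonneg ((by norm_num : (0:ℝ) ≤ 1)) hx₀)))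

/-- **(L1) on this stratum wherever the multiplier is positive** (it is a positive integer combination of monomials, so this is the
complement of their joint zero set): `0 < (L·M)·σ^0` together with the row hypotheses gives `0 ≤ polL₁`. -/
theorem strat2_L1_suppV1_nonneg (x₀ x₁ x₄ x₅ x₆ x₁₀ x₁₁ x₁₂ x₁₃ x₁₄ : ℝ)
    (hx₀ : 0 ≤ x₀) (hx₁ : 0 ≤ x₁) (hx₄ : 0 ≤ x₄) (hx₅ : 0 ≤ x₅) (hx₆ : 0 ≤ x₆) (hx₁₀ : 0 ≤ x₁₀) (hx₁₁ : 0 ≤ x₁₁) (hx₁₂ : 0 ≤ x₁₂) (hx₁₃ : 0 ≤ x₁₃) (hx₁₄ : 0 ≤ x₁₄)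
    (hr0 : 0 ≤ E3h (x₀ + x₁ + x₄ + x₅ + x₆ + x₁₀ + x₁₁ + x₁₂ + x₁₃ + x₁₄) (x₀ + x₁ + x₄ + x₅ + x₆ + x₁₀ + x₁₂) (x₀ + x₄ + x₆ + x₁₂) (x₀ + x₁ + x₄ + x₅ + x₁₀) (x₀ + x₄ + x₆ + x₁₂) (x₀ + x₁ + x₄ + x₅ + x₁₀) (x₀ + x₄) (x₀ + x₄))
    (hr1 : 0 ≤ E3h (x₀ + x₁ + x₄ + x₅ + x₆ + x₁₀ + x₁₁ + x₁₂ + x₁₃ + x₁₄) (x₀ + x₁ + x₄ + x₅ + x₆ + x₁₀ + x₁₁ + x₁₂) (x₀ + x₁ + x₄ + x₆ + x₁₁ + x₁₂) (x₀ + x₁ + x₄ + x₅ + x₁₀) (x₀ + x₁ + x₄ + x₆ + x₁₁ + x₁₂) (x₀ + x₁ + x₄ + x₅ + x₁₀) (x₀ + x₁ + x₄) (x₀ + x₁ + x₄))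
    (hM : 0 < (2 * x₁₄ + 2 * x₁₃ + 1 * x₁₂ + 2 * x₁₁ + 1 * x₁₀ + 1 * x₆ + 1 * x₅ + 1 * x₄ + 1 * x₁ + 1 * x₀)) :
    0 ≤ polL₁ x₀ x₁ 0 0 x₄ x₅ x₆ 0 0 0 x₁₀ x₁₁ x₁₂ x₁₃ x₁₄ := by
  have h := strat2_L1_suppV1_mul_nonneg x₀ x₁ x₄ x₅ x₆ x₁₀ x₁₁ x₁₂ x₁₃ x₁₄ hx₀ hx₁ hx₄ hx₅ hx₆ hx₁₀ hx₁₁ hx₁₂ hx₁₃ hx₁₄  hr0 hr1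
  exact (mul_nonneg_iff_of_pos_left hM).mp h

end CubicFourPoint

end Summit.CriticalPhenomena.PercolationContinuityZ3.Theorems
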